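import Literature.Probability.RandomPlanarGeometry.HexSAWSurfaceWallDensity
import Literature.Probability.RandomPlanarGeometry.HexSAWSurfaceWallDensityCoefficient
import Literature.Probability.RandomPlanarGeometry.HexSAWArmchairWallRateSqrtMonotone
import Mathlib.MeasureTheory.Integral.IntervalIntegral.FundThmCalculus
import Mathlib.Analysis.Convex.Continuous
import HarnessLib

/-!
# Honeycomb surface walls: the CONTACT-DEFICIT SUM RULE —
# `∫_a^b (1/2 − ρ^±(s)) ds = (κ(a) − a/2) − (κ(b) − b/2)`, hence `∫_a^∞ (1/2 − ρ^±(s)) ds = κ(a) − a/2 = ½ (log β(eᵃ)² − a)`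

Topic `Literature/Probability/RandomPlanarGeometry` (lane «pcv-sawmu», car «WALL-DENSITY-SUM-RULE», a-p6 g16).  For both wall orientations of the
honeycomb SAW (BBdGDCG zig-zag: `Wall.wallFreeEnergy`, `wallRightDensity`, `wallLeftDensity` of `HexSAWSurfaceWallDensity.lean`; Beaton armchair:
`Arm.armFreeEnergy`, `armRightDensity`, `armLeftDensity` of `HexSAWArmchairWallRateSqrtMonotone.lean`) the free energy `κ(t) = log β(eᵗ)` is convex
with one-sided derivatives `ρ⁻ ≤ ρ⁺` (the contact densities) and `κ(t) − t/2 → 0`.  The fundamental theorem of calculus for convex functions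
(Mathlib's `intervalIntegral.integral_eq_sub_of_hasDeriv_right_of_le`, §1, together with a reflection `s ↦ −s` for the left derivative) gives the
exact identity `∫_a^b ρ^± = κ(b) − κ(a)`, and therefore the SUM RULE: the total deficit of the contact density, integrated over the log-fugacity
from `a` to `∞`, equals the surface excess `κ(a) − a/2 = ½ (log β(eᵃ)² − a) ≥ 0` — for EITHER one-sided density (§2 zig-zag, §4 armchair).
With `HexSAWSurfaceWallDensityCoefficient.lean` (`log_wallRate_sq_sub_le`, `le_log_wallRate_sq_sub`) the zig-zag excess is `½ e^{−2a} (1 + O(e^{−a}))`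
(§3: `e^{2a} (κ(a) − a/2) → 1/2`), consistent with integrating the landed density expansion `1/2 − ρ = e^{−2s}(1 + o(1))` termwise.

Sources.  BBdGDCG, CMP 326 (2014) §3.1 (arXiv v5 p. 9: Proposition 5 — log-convexity; p. 10: first order).  N. R. Beaton, J. Phys. A 47 (2014)
§3.1 (arXiv v3 p. 11).  E. J. Janse van Rensburg (OUP 2000) §3.3 (free energies and their derivatives, the density of visits; the integrated
form is the thermodynamic "excess" bookkeeping).  N. Madras, G. Slade (1993) §1.2.

HONEST LABEL.  LANE THEOREM (S), OWN: an exact identity (convex FTC) packaged for the two walls + its first-order evaluation; NEW-IN-WRITING: modest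
(the identity is thermodynamic folklore; stated and kernel-checked for these models with no differentiability hypothesis).  NOT CLAIMED: improper-integral
(`∫ in Ioi a`) formulations — the limit of `∫_a^b` as `b → ∞` is used instead; armchair asymptotics of the excess (they follow the same way from the
armchair windows).
-/

noncomputable section

open Filter Asymptotics Set MeasureTheory intervalIntegral
open _root_.Topology

namespace Literature.Probability.RandomPlanarGeometry.SAW.HexBW

/-! ### §1  FTC for convex functions on `ℝ` (one-sided derivatives) -/

/-- For a convex `f : ℝ → ℝ`: `∫_a^b f'_+ = f(b) − f(a)` (`a ≤ b`), `f'_+ (s) = derivWithin f (Ioi s) s`.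
[cite: JansevanRensburg2000, §3.3 (convex free energies; one-sided derivatives)] -/
theorem integral_rightDeriv_of_convexOn_univ {f : ℝ → ℝ} (hf : ConvexOn ℝ univ f) {a b : ℝ} (hab : a ≤ b) :
    ∫ s in a..b, derivWithin f (Ioi s) s = f b - f a := by
  refine integral_eq_sub_of_hasDeriv_right_of_le hab ((hf.continuousOn isOpen_univ).mono (subset_univ _))
    (fun x _ => hf.hasDerivWithinAt_rightDeriv_of_mem_interior (by simp)) ?_
  refine MonotoneOn.intervalIntegrable ?_
  intro x _ y _ hxy
  exact hf.monotoneOn_rightDeriv (by simp) (by simp) hxy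

/-- For a convex `f : ℝ → ℝ`: `∫_a^b f'_− = f(b) − f(a)` (`a ≤ b`), `f'_− (s) = derivWithin f (Iio s) s` — by the reflection `s ↦ −s`, under which the
left derivative of `f` becomes (minus) the right derivative of `f(−·)`. [cite: JansevanRensburg2000, §3.3 (convex free energies; one-sided derivatives)] -/
theorem integral_leftDeriv_of_convexOn_univ {f : ℝ → ℝ} (hf : ConvexOn ℝ univ f) {a b : ℝ} (hab : a ≤ b) :
    ∫ s in a..b, derivWithin f (Iio s) s = f b - f a := by
  -- `g(s) = f(−s)` has right derivative `−f'_−(−s)`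
  have hderiv : ∀ x ∈ Ioo (-b) (-a), HasDerivWithinAt (fun s => f (-s)) (-derivWithin f (Iio (-x)) (-x)) (Ioi x) x := by
    intro x _
    have h1 : HasDerivWithinAt f (derivWithin f (Iio (-x)) (-x)) (Iio (-x)) (-x) :=
      hf.hasDerivWithinAt_leftDeriv_of_mem_interior (by simp)
    have h2 : HasDerivWithinAt (fun s : ℝ => -s) (-1) (Ioi x) x := (hasDerivWithinAt_id x _).neg
    have h3 := h1.comp x h2 (fun s hs => by simp only [mem_Ioi] at hs; simp only [mem_Iio]; linarith)
    simpa [Function.comp_def] using h3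
  have hcont : ContinuousOn (fun s => f (-s)) (Icc (-b) (-a)) :=
    ((hf.continuousOn isOpen_univ).comp_continuous continuous_neg (fun _ => mem_univ _)).continuousOn
  have hint : IntervalIntegrable (fun x => -derivWithin f (Iio (-x)) (-x)) volume (-b) (-a) := by
    refine MonotoneOn.intervalIntegrable ?_
    intro x _ y _ hxy
    have := hf.monotoneOn_leftDeriv (show -y ∈ interior (univ : Set ℝ) by simp)
      (show -x ∈ interior (univ : Set ℝ) by simp) (by linarith)
    simpa using this
  have hftc := integral_eq_sub_of_hasDeriv_right_of_le (by linarith : -b ≤ -a) hcont hderiv hint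
  simp only [neg_neg, intervalIntegral.integral_neg] at hftc
  have hcomp : ∫ x in (-b)..(-a), derivWithin f (Iio (-x)) (-x) = ∫ x in a..b, derivWithin f (Iio x) x := by
    have := intervalIntegral.integral_comp_neg (a := -b) (b := -a) (fun u => derivWithin f (Iio u) u)
    simpa only [neg_neg] using this
  linarith [hcomp]

end Literature.Probability.RandomPlanarGeometry.SAW.HexBW

/-! ### §2  The zig-zag wall: `∫ ρ^± = Δκ` and the sum rule -/

namespace Literature.Probability.RandomPlanarGeometry.SAW.HexBW.Wall

/-- `∫_a^b ρ⁺(s) ds = κ(b) − κ(a)` for the zig-zag wall (`a ≤ b`). [cite: BeatonBousquetMelouDeGierDuminilCopinGuttmann2014, §3.1, Proposition 5 (arXiv v5 p. 9: "log-convex")] [cite: JansevanRensburg2000, §3.3] -/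
theorem integral_wallRightDensity_eq {a b : ℝ} (hab : a ≤ b) :
    ∫ s in a..b, wallRightDensity s = wallFreeEnergy b - wallFreeEnergy a :=
  integral_rightDeriv_of_convexOn_univ convexOn_wallFreeEnergy hab

/-- `∫_a^b ρ⁻(s) ds = κ(b) − κ(a)` for the zig-zag wall (`a ≤ b`). [cite: BeatonBousquetMelouDeGierDuminilCopinGuttmann2014, §3.1, Proposition 5 (arXiv v5 p. 9: "log-convex")] [cite: JansevanRensburg2000, §3.3] -/
theorem integral_wallLeftDensity_eq {a b : ℝ} (hab : a ≤ b) :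
    ∫ s in a..b, wallLeftDensity s = wallFreeEnergy b - wallFreeEnergy a :=
  integral_leftDeriv_of_convexOn_univ convexOn_wallFreeEnergy hab

/-- ★ **Finite sum rule** (right density): `∫_a^b (1/2 − ρ⁺(s)) ds = (κ(a) − a/2) − (κ(b) − b/2)`.
[cite: BeatonBousquetMelouDeGierDuminilCopinGuttmann2014, §3.1, Proposition 5 (arXiv v5 p. 9)] [cite: JansevanRensburg2000, §3.3] -/
theorem integral_half_sub_wallRightDensity_eq {a b : ℝ} (hab : a ≤ b) :
    ∫ s in a..b, (1 / 2 - wallRightDensity s) = (wallFreeEnergy a - a / 2) - (wallFreeEnergy b - b / 2) := by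
  rw [intervalIntegral.integral_sub intervalIntegrable_const
    ((monotone_wallRightDensity.monotoneOn _).intervalIntegrable), intervalIntegral.integral_const,
    integral_wallRightDensity_eq hab, smul_eq_mul]
  ring

/-- ★ **Finite sum rule** (left density): `∫_a^b (1/2 − ρ⁻(s)) ds = (κ(a) − a/2) − (κ(b) − b/2)`.
[cite: BeatonBousquetMelouDeGierDuminilCopinGuttmann2014, §3.1, Proposition 5 (arXiv v5 p. 9)] [cite: JansevanRensburg2000, §3.3] -/
theorem integral_half_sub_wallLeftDensity_eq {a b : ℝ} (hab : a ≤ b) :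
    ∫ s in a..b, (1 / 2 - wallLeftDensity s) = (wallFreeEnergy a - a / 2) - (wallFreeEnergy b - b / 2) := by
  rw [intervalIntegral.integral_sub intervalIntegrable_const
    ((monotone_wallLeftDensity.monotoneOn _).intervalIntegrable), intervalIntegral.integral_const,
    integral_wallLeftDensity_eq hab, smul_eq_mul]
  ring

/-- The surface excess `κ(a) − a/2 = ½ (log β(eᵃ)² − a)`. [cite: BeatonBousquetMelouDeGierDuminilCopinGuttmann2014, §3.1, Proposition 5 (arXiv v5 p. 9)] -/
theorem wallFreeEnergy_sub_half_eq (a : ℝ) :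
    wallFreeEnergy a - a / 2 = (Real.log (wallRate (Real.exp a) ^ 2) - a) / 2 := by
  rw [wallFreeEnergy_apply, Real.log_pow]; push_cast; ring

/-- ★★ **THE SUM RULE (right density): `∫_a^b (1/2 − ρ⁺(s)) ds → κ(a) − a/2` as `b → ∞`** — the integrated contact deficit equals the surface excess
free energy. [cite: BeatonBousquetMelouDeGierDuminilCopinGuttmann2014, §3.1, Proposition 5 (arXiv v5 p. 9); p. 10 (first-order remark)] [cite: JansevanRensburg2000, §3.3] -/
theorem tendsto_integral_half_sub_wallRightDensity (a : ℝ) :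
    Tendsto (fun b : ℝ => ∫ s in a..b, (1 / 2 - wallRightDensity s)) atTop (𝓝 (wallFreeEnergy a - a / 2)) := by
  have h : Tendsto (fun b : ℝ => (wallFreeEnergy a - a / 2) - (wallFreeEnergy b - b / 2)) atTop
      (𝓝 ((wallFreeEnergy a - a / 2) - 0)) := tendsto_const_nhds.sub tendsto_wallFreeEnergy_sub_half
  rw [sub_zero] at h
  refine h.congr' ?_
  filter_upwards [eventually_ge_atTop a] with b hb
  rw [integral_half_sub_wallRightDensity_eq hb]

/-- ★★ **THE SUM RULE (left density): `∫_a^b (1/2 − ρ⁻(s)) ds → κ(a) − a/2` as `b → ∞`.**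
[cite: BeatonBousquetMelouDeGierDuminilCopinGuttmann2014, §3.1, Proposition 5 (arXiv v5 p. 9); p. 10 (first-order remark)] [cite: JansevanRensburg2000, §3.3] -/
theorem tendsto_integral_half_sub_wallLeftDensity (a : ℝ) :
    Tendsto (fun b : ℝ => ∫ s in a..b, (1 / 2 - wallLeftDensity s)) atTop (𝓝 (wallFreeEnergy a - a / 2)) := by
  have h : Tendsto (fun b : ℝ => (wallFreeEnergy a - a / 2) - (wallFreeEnergy b - b / 2)) atTop
      (𝓝 ((wallFreeEnergy a - a / 2) - 0)) := tendsto_const_nhds.sub tendsto_wallFreeEnergy_sub_half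
  rw [sub_zero] at h
  refine h.congr' ?_
  filter_upwards [eventually_ge_atTop a] with b hb
  rw [integral_half_sub_wallLeftDensity_eq hb]

/-- The excess is nonnegative and the partial integrals increase to it: `0 ≤ ∫_a^b (1/2 − ρ⁺) ≤ κ(a) − a/2` (`a ≤ b`).
[cite: BeatonBousquetMelouDeGierDuminilCopinGuttmann2014, §3.1, Proposition 5 (arXiv v5 p. 9: `μ(y) ≥ √y`)] -/
theorem integral_half_sub_wallRightDensity_mem_Icc {a b : ℝ} (hab : a ≤ b) :
    (∫ s in a..b, (1 / 2 - wallRightDensity s)) ∈ Icc (0 : ℝ) (wallFreeEnergy a - a / 2) := by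
  rw [integral_half_sub_wallRightDensity_eq hab]
  have h1 := half_le_wallFreeEnergy b
  have h2 : (0 : ℝ) ≤ ∫ s in a..b, (1 / 2 - wallRightDensity s) :=
    intervalIntegral.integral_nonneg hab fun s _ => by linarith [wallRightDensity_le_half s]
  rw [integral_half_sub_wallRightDensity_eq hab] at h2
  exact ⟨h2, by linarith⟩

/-! ### §3  First-order size of the zig-zag excess: `e^{2a} (κ(a) − a/2) → 1/2` -/

/-- ★ **`e^{2a} (κ(a) − a/2) → 1/2`**: the integrated deficit is `½ e^{−2a} (1 + O(e^{−a}))`, from the logarithmic window of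
`HexSAWSurfaceWallDensityCoefficient` (`y⁻² − 34996 y⁻⁴ ≤ log β² − log y ≤ y⁻² + 8748 y⁻³`, `y ≥ 163`).
[cite: BeatonBousquetMelouDeGierDuminilCopinGuttmann2014, §3.1, Proposition 5 (arXiv v5 p. 9); p. 10 (first-order remark)] [cite: JansevanRensburg2000, §3.3] -/
theorem tendsto_exp_mul_wallFreeEnergy_sub_half :
    Tendsto (fun a : ℝ => Real.exp (2 * a) * (wallFreeEnergy a - a / 2)) atTop (𝓝 (1 / 2)) := by
  -- `e^{2a} · e^{−3a} · C → 0`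
  have h0 : Tendsto (fun a : ℝ => Real.exp (-a)) atTop (𝓝 0) := Real.tendsto_exp_neg_atTop_nhds_zero
  have hlow : Tendsto (fun a : ℝ => 1 / 2 - 17498 * (Real.exp (-a) * Real.exp (-a))) atTop (𝓝 (1 / 2)) := by
    have := ((h0.mul h0).const_mul 17498).const_sub (1 / 2)
    simpa only [mul_zero, sub_zero] using this
  have hup : Tendsto (fun a : ℝ => 1 / 2 + 4374 * Real.exp (-a)) atTop (𝓝 (1 / 2)) := by
    have := (h0.const_mul 4374).const_add (1 / 2)
    simpa only [mul_zero, add_zero] using this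
  have hp2 : ∀ a : ℝ, Real.exp a ^ 2 = Real.exp (2 * a) := fun a => by rw [← Real.exp_nat_mul]; norm_num
  have hp3 : ∀ a : ℝ, Real.exp a ^ 3 = Real.exp (3 * a) := fun a => by rw [← Real.exp_nat_mul]; norm_num
  have hp4 : ∀ a : ℝ, Real.exp a ^ 4 = Real.exp (4 * a) := fun a => by rw [← Real.exp_nat_mul]; norm_num
  refine tendsto_of_tendsto_of_tendsto_of_le_of_le' hlow hup ?_ ?_
  · filter_upwards [eventually_ge_atTop (Real.log 163)] with a ha
    have hy : (163 : ℝ) ≤ Real.exp a := by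
      have := Real.exp_le_exp.2 ha; rwa [Real.exp_log (by norm_num)] at this
    have hL := le_log_wallRate_sq_sub hy
    rw [Real.log_exp] at hL
    rw [wallFreeEnergy_sub_half_eq]
    have e2 : Real.exp (2 * a) * (1 / Real.exp a ^ 2) = 1 := by
      rw [hp2]; field_simp
    have e4 : Real.exp (2 * a) * (1 / Real.exp a ^ 4) = Real.exp (-a) * Real.exp (-a) := by
      rw [hp4, one_div, ← Real.exp_neg, ← Real.exp_add, ← Real.exp_add]; congr 1; ring
    have hpos := Real.exp_pos (2 * a)
    have hmain : 1 - 34996 * (Real.exp (-a) * Real.exp (-a)) ≤ Real.exp (2 * a) * (Real.log (wallRate (Real.exp a) ^ 2) - a) := by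
      have := mul_le_mul_of_nonneg_left hL hpos.le
      rw [mul_sub, e2, show Real.exp (2 * a) * (34996 / Real.exp a ^ 4) = 34996 * (Real.exp (2 * a) * (1 / Real.exp a ^ 4)) by ring,
        e4] at this
      exact this
    rw [show Real.exp (2 * a) * ((Real.log (wallRate (Real.exp a) ^ 2) - a) / 2) =
      Real.exp (2 * a) * (Real.log (wallRate (Real.exp a) ^ 2) - a) / 2 by ring]
    linarith
  · filter_upwards [eventually_ge_atTop (0 : ℝ)] with a ha
    have hy : (1 : ℝ) ≤ Real.exp a := by simpa using Real.exp_le_exp.2 ha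
    have hU := log_wallRate_sq_sub_le hy
    rw [Real.log_exp] at hU
    rw [wallFreeEnergy_sub_half_eq]
    have e2 : Real.exp (2 * a) * (1 / Real.exp a ^ 2) = 1 := by
      rw [hp2]; field_simp
    have e3 : Real.exp (2 * a) * (1 / Real.exp a ^ 3) = Real.exp (-a) := by
      rw [hp3, one_div, ← Real.exp_neg, ← Real.exp_add]; congr 1; ring
    have hpos := Real.exp_pos (2 * a)
    have hmain : Real.exp (2 * a) * (Real.log (wallRate (Real.exp a) ^ 2) - a) ≤ 1 + 8748 * Real.exp (-a) := by
      have := mul_le_mul_of_nonneg_left hU hpos.le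
      rw [mul_add, e2, show Real.exp (2 * a) * (8748 / Real.exp a ^ 3) = 8748 * (Real.exp (2 * a) * (1 / Real.exp a ^ 3)) by ring,
        e3] at this
      exact this
    rw [show Real.exp (2 * a) * ((Real.log (wallRate (Real.exp a) ^ 2) - a) / 2) =
      Real.exp (2 * a) * (Real.log (wallRate (Real.exp a) ^ 2) - a) / 2 by ring]
    linarith

/-- ★ **The integrated deficit is asymptotically `½ e^{−2a}`**: `e^{2a} · lim_b ∫_a^b (1/2 − ρ⁺) → 1/2` in the form
`(fun a => κ(a) − a/2) ~ ½ e^{−2a}`. [cite: BeatonBousquetMelouDeGierDuminilCopinGuttmann2014, §3.1, Proposition 5 (arXiv v5 p. 9); p. 10 (first-order remark)] -/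
theorem isEquivalent_wallFreeEnergy_sub_half :
    (fun a : ℝ => wallFreeEnergy a - a / 2) ~[atTop] (fun a : ℝ => 1 / 2 * Real.exp (-(2 * a))) := by
  refine (isEquivalent_iff_tendsto_one ?_).2 ?_
  · exact Eventually.of_forall fun a => by positivity
  · have h := tendsto_exp_mul_wallFreeEnergy_sub_half.mul_const 2
    rw [show (1 / 2 : ℝ) * 2 = 1 by norm_num] at h
    refine h.congr fun a => ?_
    rw [Pi.div_apply, Real.exp_neg]
    field_simp

end Literature.Probability.RandomPlanarGeometry.SAW.HexBW.Wall

/-! ### §4  The armchair wall: the same sum rule -/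

namespace Literature.Probability.RandomPlanarGeometry.SAW.HexBW.Arm

/-- `∫_a^b ρ⁺_rot(s) ds = κ_rot(b) − κ_rot(a)` (`a ≤ b`). [cite: Beaton2014RotatedHoneycomb, §3.1 (arXiv v3 p. 11: log-convexity)] [cite: JansevanRensburg2000, §3.3] -/
theorem integral_armRightDensity_eq {a b : ℝ} (hab : a ≤ b) :
    ∫ s in a..b, armRightDensity s = armFreeEnergy b - armFreeEnergy a :=
  integral_rightDeriv_of_convexOn_univ convexOn_armFreeEnergy hab

/-- `∫_a^b ρ⁻_rot(s) ds = κ_rot(b) − κ_rot(a)` (`a ≤ b`). [cite: Beaton2014RotatedHoneycomb, §3.1 (arXiv v3 p. 11: log-convexity)] [cite: JansevanRensburg2000, §3.3] -/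
theorem integral_armLeftDensity_eq {a b : ℝ} (hab : a ≤ b) :
    ∫ s in a..b, armLeftDensity s = armFreeEnergy b - armFreeEnergy a :=
  integral_leftDeriv_of_convexOn_univ convexOn_armFreeEnergy hab

/-- ★ **Finite sum rule (armchair, right density)**: `∫_a^b (1/2 − ρ⁺_rot) = (κ_rot(a) − a/2) − (κ_rot(b) − b/2)`.
[cite: Beaton2014RotatedHoneycomb, §3.1 (arXiv v3 p. 11)] [cite: JansevanRensburg2000, §3.3] -/
theorem integral_half_sub_armRightDensity_eq {a b : ℝ} (hab : a ≤ b) :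
    ∫ s in a..b, (1 / 2 - armRightDensity s) = (armFreeEnergy a - a / 2) - (armFreeEnergy b - b / 2) := by
  rw [intervalIntegral.integral_sub intervalIntegrable_const
    ((monotone_armRightDensity.monotoneOn _).intervalIntegrable), intervalIntegral.integral_const,
    integral_armRightDensity_eq hab, smul_eq_mul]
  ring

/-- ★ **Finite sum rule (armchair, left density)**: `∫_a^b (1/2 − ρ⁻_rot) = (κ_rot(a) − a/2) − (κ_rot(b) − b/2)`.
[cite: Beaton2014RotatedHoneycomb, §3.1 (arXiv v3 p. 11)] [cite: JansevanRensburg2000, §3.3] -/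
theorem integral_half_sub_armLeftDensity_eq {a b : ℝ} (hab : a ≤ b) :
    ∫ s in a..b, (1 / 2 - armLeftDensity s) = (armFreeEnergy a - a / 2) - (armFreeEnergy b - b / 2) := by
  rw [intervalIntegral.integral_sub intervalIntegrable_const
    ((monotone_armLeftDensity.monotoneOn _).intervalIntegrable), intervalIntegral.integral_const,
    integral_armLeftDensity_eq hab, smul_eq_mul]
  ring

/-- ★★ **THE ARMCHAIR SUM RULE (right density): `∫_a^b (1/2 − ρ⁺_rot(s)) ds → κ_rot(a) − a/2`.**
[cite: Beaton2014RotatedHoneycomb, §3.1 (arXiv v3 pp. 11, 14)] [cite: JansevanRensburg2000, §3.3] -/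
theorem tendsto_integral_half_sub_armRightDensity (a : ℝ) :
    Tendsto (fun b : ℝ => ∫ s in a..b, (1 / 2 - armRightDensity s)) atTop (𝓝 (armFreeEnergy a - a / 2)) := by
  have h : Tendsto (fun b : ℝ => (armFreeEnergy a - a / 2) - (armFreeEnergy b - b / 2)) atTop
      (𝓝 ((armFreeEnergy a - a / 2) - 0)) := tendsto_const_nhds.sub tendsto_armFreeEnergy_sub_half
  rw [sub_zero] at h
  refine h.congr' ?_
  filter_upwards [eventually_ge_atTop a] with b hb
  rw [integral_half_sub_armRightDensity_eq hb]

/-- ★★ **THE ARMCHAIR SUM RULE (left density): `∫_a^b (1/2 − ρ⁻_rot(s)) ds → κ_rot(a) − a/2`.**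
[cite: Beaton2014RotatedHoneycomb, §3.1 (arXiv v3 pp. 11, 14)] [cite: JansevanRensburg2000, §3.3] -/
theorem tendsto_integral_half_sub_armLeftDensity (a : ℝ) :
    Tendsto (fun b : ℝ => ∫ s in a..b, (1 / 2 - armLeftDensity s)) atTop (𝓝 (armFreeEnergy a - a / 2)) := by
  have h : Tendsto (fun b : ℝ => (armFreeEnergy a - a / 2) - (armFreeEnergy b - b / 2)) atTop
      (𝓝 ((armFreeEnergy a - a / 2) - 0)) := tendsto_const_nhds.sub tendsto_armFreeEnergy_sub_half
  rw [sub_zero] at h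
  refine h.congr' ?_
  filter_upwards [eventually_ge_atTop a] with b hb
  rw [integral_half_sub_armLeftDensity_eq hb]

end Literature.Probability.RandomPlanarGeometry.SAW.HexBW.Arm
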